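import Summits.ResolutionOfSingularities.ResolutionOfSingularities.Theorems.WeightedInvariantOrderSemicontinuousSmooth
import Literature.AlgebraicGeometry.Resolution.RegularLocalOrderValuation
import HarnessLib

/-!
# Clause (c8) `IotaUpperSemicontinuous` for every order-type class function on smooth schemes over a field

Topic: `Summits/ResolutionOfSingularities/ResolutionOfSingularities/Theorems`. Helper for the door item
`HypersurfaceCentreConstruction` (statement `stmt-ResolutionOfSingularities-19897`, route `WeightedInvariant`),
design clause (c8) of `res-L1-w43-plan-1`'s H2a‴ (`L/res-L1-w43-plan-1/eft_sketch_v6.lean` 466626a584f3567b /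
v7 570ab2c9da355249): «for `Y` smooth quasi-compact over a field, `f ∈ Γ(Y, 𝒪_Y)`, `α`, the set
`{y | α ≤ ι 𝒪_{Y,y} f_y}` is closed».  res-L1-w43-plan-1 RULING 2026-08-27T05:32:15Z (2): «039 keeps (b) the
`IotaUpperSemicontinuous iotaOrd` adapter + the smooth-Y instance».  This file is the adapter in GENERIC form —
it covers every class function that reads `φ ∘ ord` on local rings for some `φ : ℕ∞ → Γ` monotone on the
naturals (the value at `⊤`, i.e. at a zero germ, is unconstrained: junk `0`, `ω`, anything), which is the shape
of ORDER (o11)'s `iotaOrd := ordOfENat ∘ Resolution.adicOrder` (res-type-073, part 2/2 pending at the time of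
writing); the one-line instance `IotaUpperSemicontinuous iotaOrd` follows by unfolding `iotaOrd` at the (local)
stalks once (o11) part 2 and the (o16) clause module are in the tree.

[OURS · L1 W4.3] Replaces the role of NO printed item; NOT a statement of the manuscript
[claim: Hironaka2017, status: under-review]. AI work, weaker than expert review.

## What is proved (all on `Y` smooth and quasi-compact over an arbitrary field `k₀`, `f ∈ Γ(Y, ⊤)`)

* `OrderSemicontinuity.adicOrder_germ_eq_idealOrder` — `ord(germ_x f)` (tree `Resolution.adicOrder`, `ℕ∞`) is
  the tree's `Resolution.idealOrder` of the ideal sheaf generated by `f`; `adicOrder_germ_eq_top_iff` — it is `⊤`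
  iff the germ vanishes (Krull); `isClosed_setOf_germ_ne_zero`.
* `isClosed_setOf_le_adicOrder_germ` — `{y | n ≤ ord(germ_y f)}` is closed for every `n : ℕ∞`
  (from `isClosed_setOf_le_idealOrder_span_singleton`, file `WeightedInvariantOrderSemicontinuousSmooth`).
* `isClosed_setOf_le_comp_adicOrder_germ` — **for every preorder `Γ`, every `φ : ℕ∞ → Γ` monotone on `ℕ`, and
  every `α : Γ`, the set `{y | α ≤ φ (ord (germ_y f))}` is closed**: with `n₀` the least natural value accepted
  by `α` it is `{n₀ ≤ ord}` or `{n₀ ≤ ord} ∩ {germ ≠ 0}` (according as `α ≤ φ ⊤` or not), else `{ord = ⊤}` or `∅`.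
* `isClosed_setOf_le_ordinal_adicOrder_germ` — the `Ordinal`-valued case `φ n = n` on `ℕ`.

## References

* V. Cossart, O. Piltant, J. Algebra 320 (2008), proof of Prop. 4.2. [cite: CossartPiltant2008, Prop. 4.2 (proof)]
* H. Matsumura, *Commutative Ring Theory*, Thm. 8.10 (Krull intersection theorem). [cite: Matsumura1987, Thm. 8.10]
-/

noncomputable section

open CategoryTheory AlgebraicGeometry TopologicalSpace Topology IsLocalRing Opposite
open Literature.AlgebraicGeometry.Resolution

set_option linter.dupNamespace false -- mandated namespace of this single-conjunct summit

/-! ## The 𝔪-adic order of the germ (`Resolution.adicOrder`) and order-type class functions -/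

namespace Summit.ResolutionOfSingularities.ResolutionOfSingularities.Theorems

namespace OrderSemicontinuity

universe u

variable {X : Scheme.{u}}

/-- The 𝔪-adic order of the germ of a global section `f` at `x` (tree `Resolution.adicOrder`, valued in `ℕ∞`)
is the order at `x` of the ideal sheaf generated by `f` (tree `Resolution.idealOrder`). [folklore] -/
theorem adicOrder_germ_eq_idealOrder (f : Γ(X, ⊤)) (x : X) :
    adicOrder ((X.presheaf.germ ⊤ x trivial).hom f) =
      idealOrder (Scheme.IdealSheafData.ofIdealTop (Ideal.span {f})) x := by
  refine le_antisymm ?_ ?_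
  · refine ENat.forall_natCast_le_iff_le.mp fun n hn => ?_
    rw [le_idealOrder_span_singleton_iff]
    exact (le_adicOrder_iff _ n).mp hn
  · refine ENat.forall_natCast_le_iff_le.mp fun n hn => ?_
    rw [le_adicOrder_iff]
    exact (le_idealOrder_span_singleton_iff f x n).mp hn

/-- The locus where the germ of `f` is non-zero is closed (complement of the open zero-germ locus).
[folklore] -/
theorem isClosed_setOf_germ_ne_zero (f : Γ(X, ⊤)) :
    IsClosed {x : X | (X.presheaf.germ ⊤ x trivial).hom f ≠ 0} := by
  have : {x : X | (X.presheaf.germ ⊤ x trivial).hom f ≠ 0} =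
      {x : X | (X.presheaf.germ ⊤ x trivial).hom f = 0}ᶜ := by
    ext x; simp
  rw [this]
  exact (isOpen_setOf_germ_eq_zero f).isClosed_compl

/-- On a locally Noetherian scheme, `ord(germ_x f) = ⊤ ⟺ germ_x f = 0` (Krull's intersection theorem in the
Noetherian local ring `𝒪_{X,x}`). [cite: Matsumura1987, Thm. 8.10] -/
theorem adicOrder_germ_eq_top_iff [IsLocallyNoetherian X] (f : Γ(X, ⊤)) (x : X) :
    adicOrder ((X.presheaf.germ ⊤ x trivial).hom f) = ⊤ ↔ (X.presheaf.germ ⊤ x trivial).hom f = 0 :=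
  adicOrder_eq_top_iff _

end OrderSemicontinuity

open OrderSemicontinuity

universe u v

section Smooth

/-- **u.s.c. of the `ℕ∞`-valued order**: on a smooth quasi-compact scheme over a field, every super-level set
`{y | n ≤ ord(germ_y f)}` (`n : ℕ∞`, tree `Resolution.adicOrder`) is closed. [OURS · L1 W4.3]
[cite: CossartPiltant2008, Prop. 4.2 (proof)] -/
theorem isClosed_setOf_le_adicOrder_germ (k₀ : Type u) [Field k₀] (Y : Scheme.{u})
    (hY : Y ⟶ Spec (CommRingCat.of k₀)) [Smooth hY] [QuasiCompact hY] (f : Γ(Y, ⊤)) (n : ℕ∞) :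
    IsClosed {y : Y | n ≤ adicOrder ((Y.presheaf.germ ⊤ y trivial).hom f)} := by
  have hset : {y : Y | n ≤ adicOrder ((Y.presheaf.germ ⊤ y trivial).hom f)} =
      {y : Y | n ≤ idealOrder (Scheme.IdealSheafData.ofIdealTop (Ideal.span {f})) y} := by
    ext y; rw [Set.mem_setOf_eq, Set.mem_setOf_eq, adicOrder_germ_eq_idealOrder]
  rw [hset]
  exact isClosed_setOf_le_idealOrder_span_singleton k₀ Y hY f n

/-- **u.s.c. of every order-TYPE class function.** Let `φ : ℕ∞ → Γ` be any map into a preorder that is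
MONOTONE ON THE NATURALS (no condition at `⊤` — the value at a zero germ may be junk, e.g. `0` for a
`Nat.sSup`-based order, or `ω`).  Then on a smooth quasi-compact scheme over a field every super-level set of
`y ↦ φ (ord (germ_y f))` is closed.  This is clause (c8) `IotaUpperSemicontinuous` of the H2a‴ design for every
class function that reads `φ ∘ adicOrder` on local rings (the (o11) order function `iotaOrd` is of this shape).
[OURS · L1 W4.3] [cite: CossartPiltant2008, Prop. 4.2 (proof)] -/
theorem isClosed_setOf_le_comp_adicOrder_germ (k₀ : Type u) [Field k₀] (Y : Scheme.{u})
    (hY : Y ⟶ Spec (CommRingCat.of k₀)) [Smooth hY] [QuasiCompact hY] (f : Γ(Y, ⊤))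
    {Γ : Type v} [Preorder Γ] (φ : ℕ∞ → Γ) (hφ : ∀ m n : ℕ, m ≤ n → φ m ≤ φ n) (α : Γ) :
    IsClosed {y : Y | α ≤ φ (adicOrder ((Y.presheaf.germ ⊤ y trivial).hom f))} := by
  classical
  haveI : IsLocallyNoetherian Y := LocallyOfFiniteType.isLocallyNoetherian hY
  -- notation
  set ordg : Y → ℕ∞ := fun y => adicOrder ((Y.presheaf.germ ⊤ y trivial).hom f) with hordg
  have htop : ∀ y : Y, ordg y = ⊤ ↔ (Y.presheaf.germ ⊤ y trivial).hom f = 0 := fun y =>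
    adicOrder_germ_eq_top_iff f y
  -- the closed building blocks
  have hC : ∀ n : ℕ∞, IsClosed {y : Y | n ≤ ordg y} := fun n => isClosed_setOf_le_adicOrder_germ k₀ Y hY f n
  have hNZ : IsClosed {y : Y | (Y.presheaf.germ ⊤ y trivial).hom f ≠ 0} := isClosed_setOf_germ_ne_zero f
  by_cases hT : ∃ n : ℕ, α ≤ φ n
  · -- `n₀` = the least natural value accepted; on finite orders `α ≤ φ m ↔ n₀ ≤ m`
    set n₀ := Nat.find hT with hn₀
    have hfin : ∀ m : ℕ, α ≤ φ m ↔ n₀ ≤ m := fun m =>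
      ⟨fun h => Nat.find_min' hT h, fun h => le_trans (Nat.find_spec hT) (hφ _ _ h)⟩
    by_cases hτ : α ≤ φ ⊤
    · -- the super-level set is `{n₀ ≤ ord}`
      have hset : {y : Y | α ≤ φ (ordg y)} = {y : Y | (n₀ : ℕ∞) ≤ ordg y} := by
        ext y
        simp only [Set.mem_setOf_eq]
        cases h : ordg y with
        | top => simp [hτ]
        | coe m => rw [hfin m]; exact_mod_cast Iff.rfl
      show IsClosed {y : Y | α ≤ φ (ordg y)}
      rw [hset]; exact hC n₀
    · -- the super-level set is `{n₀ ≤ ord} ∩ {germ ≠ 0}`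
      have hset : {y : Y | α ≤ φ (ordg y)} =
          {y : Y | (n₀ : ℕ∞) ≤ ordg y} ∩ {y : Y | (Y.presheaf.germ ⊤ y trivial).hom f ≠ 0} := by
        ext y
        simp only [Set.mem_setOf_eq, Set.mem_inter_iff, ne_eq, ← htop y]
        cases h : ordg y with
        | top => simp [hτ]
        | coe m =>
          rw [hfin m]
          simp only [ENat.coe_ne_top, not_false_eq_true, and_true]
          exact_mod_cast Iff.rfl
      show IsClosed {y : Y | α ≤ φ (ordg y)}
      rw [hset]; exact (hC n₀).inter hNZ
  · -- no natural value is accepted: the set is `{ord = ⊤}` or `∅`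
    push Not at hT
    by_cases hτ : α ≤ φ ⊤
    · have hset : {y : Y | α ≤ φ (ordg y)} = {y : Y | (⊤ : ℕ∞) ≤ ordg y} := by
        ext y
        simp only [Set.mem_setOf_eq, top_le_iff]
        cases h : ordg y with
        | top => simp [hτ]
        | coe m => simp [hT m]
      show IsClosed {y : Y | α ≤ φ (ordg y)}
      rw [hset]; exact hC ⊤
    · have hset : {y : Y | α ≤ φ (ordg y)} = ∅ := by
        ext y
        simp only [Set.mem_setOf_eq, Set.mem_empty_iff_false, iff_false]
        cases h : ordg y with
        | top => exact hτ
        | coe m => exact hT m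
      show IsClosed {y : Y | α ≤ φ (ordg y)}
      rw [hset]; exact isClosed_empty

/-- The `Ordinal`-valued case: any `φ : ℕ∞ → Ordinal` with `φ n = n` on the naturals (whatever its value at
`⊤`) gives closed super-level sets `{y | α ≤ φ (ord (germ_y f))}` on a smooth quasi-compact scheme over a
field — the shape of (o11)'s `iotaOrd` restricted to the (local) stalks. [OURS · L1 W4.3]
[cite: CossartPiltant2008, Prop. 4.2 (proof)] -/
theorem isClosed_setOf_le_ordinal_adicOrder_germ (k₀ : Type u) [Field k₀] (Y : Scheme.{u})
    (hY : Y ⟶ Spec (CommRingCat.of k₀)) [Smooth hY] [QuasiCompact hY] (f : Γ(Y, ⊤))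
    (φ : ℕ∞ → Ordinal.{v}) (hφ : ∀ m : ℕ, φ m = m) (α : Ordinal.{v}) :
    IsClosed {y : Y | α ≤ φ (adicOrder ((Y.presheaf.germ ⊤ y trivial).hom f))} :=
  isClosed_setOf_le_comp_adicOrder_germ k₀ Y hY f φ
    (fun m n h => by rw [hφ m, hφ n]; exact_mod_cast h) α

end Smooth

end Summit.ResolutionOfSingularities.ResolutionOfSingularities.Theorems

end
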